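import Summits.QuantumFields.YangMills.Theorems.UnitScaleTiltProp7CovLogTowerDampedOfRegPrT3
import Summits.QuantumFields.YangMills.Theorems.UnitScaleTiltProp7TwistedLevelMassOfRegPr
import Summits.QuantumFields.YangMills.Theorems.UnitScaleTiltProp7Chart48SymUntwisted
import Summits.QuantumFields.YangMills.Theorems.UnitScaleTiltProp7JointRowOfLevelMassesQ
import HarnessLib

/-!
# Route `UnitScaleTilt`, crux K1 «MinimiserStabilityRegPr» (stmt-QuantumFields-19200), route-R E′ (A′)-on-Σ (★★OWNER RULING g28-№13 ∕ g29-№16), package P-A2 «JOINT-Σ» —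
# **F4″-S: THE ℓ¹ JOINT ROW OF THE SYMMETRIC CHART REMAINDER IN (n3)'s `pertVar` CURRENCY**
# `Σ_ĉ ‖C^{twS}_W(iD)(ĉ)‖ ≤ 10⁹L⁴·(A·(L²∕(L−q))·ℓ⁻¹ + B·(L²∕(L³−q))·ℓ)`, `ℓ = L^{K−n}`, `A = 4(21+10080L³)·M₀`, `B = 4(3+720L²)·(28800L⁴·KD + 600000L⁴·ℓ⁻²·M₀)`,
# `q = 1 + 2·10¹⁵L⁵ε₀` — for a printed-regular `W ∈ 𝔘_k(ε₀)` and a Hermitian traceless exponent `D` (competitor `e^{iD}W`), `M₀ = Σ_b‖pertVar W (e^{iD}W) b‖²`, `KD` = (n3)'s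
# curl² + div² of `pertVar` — the knit F0″ (px18 g3) ∘ F1″ (routeR-w6 g7 ∕ px15 g3) ∘ F2″ (this seat) ∘ F3″ (px17 g3 ∕ px22 g4) ∘ `levelSum_damped_le_q` (this seat), every row by name.

Cell `ym3-torus`, D-0154 (3c) twin-width seat `ym-routeR-w3` (gen 7); ★p1 g18 ✓p696737 word (1) («cut your assembler's last line to the `hPA2` text»).  `--supports
stmt-QuantumFields-19200 --as helper`, count-neutral, def-free.  YM₃ on T³ is a ladder rung (R3), NOT the Clay problem; nothing here is a claim about the stub, the crux, d = 4
or the mass gap.  THIS FILE is the S-half in (n3) letters; the X-currency reading (routeR-w4 g15 ✓`Prop7PertVarCurrencyExchange`: `M₀ ≤ Σ‖D‖²`, `KD ≤ 4N·K_W(iD) + …`) cut to the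
`hPA2` letters of ✓`Prop7HcoSEndToEnd` and the COMB triangle (px18 g3 ✓`Prop7CombSymBCHDoor` + (R1)(R2)) are the sibling files.

THE ARGUMENT (all by name).  (1) ✓`Prop7CovLogTowerDampedOfRegPr.l1_CmapTwS_le_damped_levelMasses_damped`: `Σ_ĉ‖C^{twS}(X)(ĉ)‖ ≤ Σ_{l<k} κ₀^{k−1−l}·(10⁹L⁴·Σ_b‖Fm l X b‖²)`,
`κ₀ = L⁻² + 2·10¹⁵L³ε₀`, for the formal log tower `Fm` of ✓`Prop7CovLogTower.exists_iterate`; (2) ✓`Prop7CovLogTower.logTower_eq_iterate` (windows by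
✓`Prop7CovLogTowerOfRegPr.hwinr_of_regPr`) identifies `Fm l X b` with `log(V^{(l)}(b)·W̄^{(l)}(b)⁻¹)`, `V^{(l)} = dbarCovIterU l W♭ (e^{X}W♭)`, and
✓`Prop7Chart48SymUntwisted.unitsField_toUField_emb15_expHermField` identifies `e^{iD}W♭` with `(emb15 W (expHermField D))♭` at `X = iD`; (3) px17 g3's
✓`Prop7TwistedLevelMassOfRegPr.twistedLevelMass_hM_log_of_regPr` is then the `hM` row `Σ_b‖Fm l X b‖² ≤ A·(Lˡ)⁻¹ + B·Lˡ`; (4) ✓`Prop7JointRowOfLevelMassesQ.levelSum_damped_le_q` at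
`κ := κ₀ = q·L⁻²`, `q = 1 + 2·10¹⁵L⁵ε₀ < L` (from `10¹⁴L⁹ε₀ ≤ 1`, `L ≥ 3`).

WHAT THIS FILE PROVES (sorry-free).
* `q_lt_L`, `kappa0_eq` — the damping letter `κ₀ = q·(L²)⁻¹` and `q < L` under px17's window.
* ★★★ **`sum_norm_CmapTwS_le_jointRow_pertVar`** — the row above (windows: `10⁹L²e ≤ 1`, `10¹⁴L⁹ε₀ ≤ 1`, `4s ≤ 1`, `4·10¹¹L⁹(ℓs) ≤ 1`, `‖D b‖ ≤ s`, `‖iD‖ < e·η`).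
HONEST SCOPE.  A knit by name; constants crude, L-only; nothing of `hPA2`'s COMB row, hcoS, E′, EX or the crux is claimed.

References: T. Bałaban, CMP **102** (1985) 277–309 [Balaban1985Variational] ((44)–(48) pp.285–286, Prop. 7 p.299); CMP **98** (1985) 17–51 [Balaban1985Averaging] ((89) p.31,
(97) p.32, (125)–(127) p.36, (150)–(152) p.40); CMP **95** (1984) 17–40 [Balaban1984PropagatorsI] ((1.18)–(1.20) pp.19–20).
-/

set_option autoImplicit false

noncomputable section

open scoped BigOperators Matrix.Norms.L2Operator Matrix

namespace Summit.QuantumFields.YangMills.Theorems.Prop7CmapTwSJointRowPertVar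

open NormedSpace Finset
open Literature.MathematicalPhysics.QuantumFieldTheory.Balaban1983to89
open Literature.MathematicalPhysics.QuantumFieldTheory.Balaban1983to89.T3ContinuumYM3Torus
open T4Continuum BlockAveraging AveragingRT ExpMeanLog BlockAveragingEMLLinearised BlockAveragingEMLLinearisedBackground
open MatrixLog (mlog)
open B9Eq39Adjoint (curl divB)
open B9TorusCalculus (torusT)
open B7Prop1Explicit (expUnit val_expUnit)
open B10Eq27TorusAxialLog (unitsField toUField)
open T3PrintedRegularMinimiser (RegPr)
open T3SectALandauChart (eta eta_pos bgUnits emb15 pos_of_regPr)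
open Summit.QuantumFields.YangMills.Theorems.Prop7TPrint (expHermField)
open Summit.QuantumFields.YangMills.Theorems.Prop8Chart (emlAvgU emlIterU)
open Summit.QuantumFields.YangMills.Theorems.Prop7SymAvgTwSym (dbarCovU dbarCovIterU CmapTwS)
open Summit.QuantumFields.YangMills.Theorems.Prop7CovLogTower (exists_iterate exists_lin logTower_eq_iterate)
open Summit.QuantumFields.YangMills.Theorems.Prop7CovLogTowerOfRegPr (hwinr_of_regPr)
open Summit.QuantumFields.YangMills.Theorems.Prop7CovLogTowerDampedOfRegPr (l1_CmapTwS_le_damped_levelMasses_damped)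
open Summit.QuantumFields.YangMills.Theorems.Prop7TwistedLevelMassOfRegPr (twistedLevelMass_hM_log_of_regPr)
open Summit.QuantumFields.YangMills.Theorems.Prop7Chart48SymUntwisted (unitsField_toUField_emb15_expHermField)
open Summit.QuantumFields.YangMills.Theorems.Prop7JointRowOfLevelMassesQ (levelSum_damped_le_q)

variable (F : T3Family) (n K : ℕ) (h : n ≤ K)
variable {n K}

/-! ## §1 The damping letter: `κ₀ = q·L⁻²`, `q < L` -/

/-- `q := 1 + 2·10¹⁵L⁵ε₀ < L` under px17's window `10¹⁴L⁹ε₀ ≤ 1` (`L ≥ 3`, `0 ≤ ε₀`). [folklore] -/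
theorem q_lt_L {ε₀ : ℝ} (hε₀ : 0 ≤ ε₀) (hWε : 100000000000000 * (F.L : ℝ) ^ 9 * ε₀ ≤ 1) : 1 + 2 * 10 ^ 15 * (F.L : ℝ) ^ 5 * ε₀ < (F.L : ℝ) := by
  have hL3 : (3 : ℝ) ≤ (F.L : ℝ) := Prop7CurvedLandauKnitT3.three_le_L F
  have hL0 : (0 : ℝ) < (F.L : ℝ) := by linarith
  have h4 : (81 : ℝ) ≤ (F.L : ℝ) ^ 4 := by nlinarith [sq_nonneg ((F.L : ℝ) ^ 2 - 9), sq_nonneg (F.L : ℝ)]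
  -- `2·10¹⁵L⁵ε₀·L⁴ = 20·(10¹⁴L⁹ε₀) ≤ 20`, so `2·10¹⁵L⁵ε₀ ≤ 20∕81 < 1 ≤ L − 1`
  have h5 : 0 ≤ (F.L : ℝ) ^ 5 * ε₀ := by positivity
  have hkey : 2 * 10 ^ 15 * (F.L : ℝ) ^ 5 * ε₀ * (F.L : ℝ) ^ 4 ≤ 20 := by
    have e : 2 * 10 ^ 15 * (F.L : ℝ) ^ 5 * ε₀ * (F.L : ℝ) ^ 4 = 20 * (100000000000000 * (F.L : ℝ) ^ 9 * ε₀) := by ring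
    rw [e]; linarith
  have hsmall : 2 * 10 ^ 15 * (F.L : ℝ) ^ 5 * ε₀ ≤ 20 / 81 := by
    rw [le_div_iff₀ (by norm_num : (0 : ℝ) < 81)]
    nlinarith [mul_le_mul_of_nonneg_left h4 (by positivity : (0 : ℝ) ≤ 2 * 10 ^ 15 * (F.L : ℝ) ^ 5 * ε₀)]
  linarith

/-- `κ₀ = (L²)⁻¹ + 2·10¹⁵L³ε₀ = q·(L²)⁻¹`. [folklore] -/
theorem kappa0_eq {ε₀ : ℝ} : ((F.L : ℝ) ^ 2)⁻¹ + 2 * 10 ^ 15 * (F.L : ℝ) ^ 3 * ε₀ = (1 + 2 * 10 ^ 15 * (F.L : ℝ) ^ 5 * ε₀) * ((F.L : ℝ) ^ 2)⁻¹ := by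
  have hL3 : (3 : ℝ) ≤ (F.L : ℝ) := Prop7CurvedLandauKnitT3.three_le_L F
  have hL0 : (F.L : ℝ) ≠ 0 := by positivity
  field_simp

/-! ## §2 ★★★ The ℓ¹ joint row of `C^{twS}` in `pertVar` currency -/

set_option maxHeartbeats 400000 in
/-- ★★★ **F4″-S — THE ℓ¹ JOINT ROW OF THE SYMMETRIC CHART REMAINDER AT A PRINTED-REGULAR BACKGROUND, (n3) CURRENCY.**  `W ∈ 𝔘_k(ε₀)` (`RegPr F n K ε₀ W`), `D` bondwise Hermitian
traceless with `‖D b‖ ≤ s` and `‖iD‖ < e·η`; windows `10⁹L²e ≤ 1`, `10¹⁴L⁹ε₀ ≤ 1`, `4s ≤ 1`, `4·10¹¹L⁹(L^{K−n}·s) ≤ 1`.  Then, with `M₀ = Σ_b‖pertVar W (e^{iD}W) b‖²`, `KD` the (n3)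
curl² + div² of `pertVar W (e^{iD}W)` at background `W`, `ℓ = L^{K−n}`, `q = 1 + 2·10¹⁵L⁵ε₀`:
`Σ_{ĉ : PBond (F.P n) 0} ‖CmapTwS F n K h W (iD) ĉ‖ ≤ 10⁹L⁴·(4(21+10080L³)·M₀·(L²∕(L−q))·ℓ⁻¹ + (4(3+720L²)·28800L⁴·KD + 4(3+720L²)·600000L⁴·ℓ⁻²·M₀)·(L²∕(L³−q))·ℓ)`.
[cite: Balaban1985Variational, (44)-(48) pp.285-286, Prop. 7 p.299; Balaban1985Averaging, (125)-(127) p.36, (150)-(152) p.40; Balaban1984PropagatorsI, (1.18)-(1.20) pp.19-20] -/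
theorem sum_norm_CmapTwS_le_jointRow_pertVar {ε₀ e s : ℝ} (he : 0 < e) (hWe : 10 ^ 9 * (F.L : ℝ) ^ 2 * e ≤ 1)
    (hWε : 100000000000000 * (F.L : ℝ) ^ 9 * ε₀ ≤ 1)
    (hs0 : 0 ≤ s) (hs4 : 4 * s ≤ 1) (hsL : 400000000000 * (F.L : ℝ) ^ 9 * (((F.L : ℝ) ^ (K - n)) * s) ≤ 1)
    (W : GaugeField (F.P K) 0 (Matrix.specialUnitaryGroup (Fin 2) ℂ)) (hreg : RegPr F n K ε₀ W)
    (D : PBond (F.P K) 0 → Matrix (Fin 2) (Fin 2) ℂ) (hD : ∀ b : PBond (F.P K) 0, (D b).IsHermitian ∧ Matrix.trace (D b) = 0)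
    (hs : ∀ b : PBond (F.P K) 0, ‖D b‖ ≤ s) (hXr : ‖(fun b : PBond (F.P K) 0 => Complex.I • D b)‖ < e * eta F n K) :
    ∑ c : PBond (F.P n) 0, ‖CmapTwS F n K h W (fun b : PBond (F.P K) 0 => Complex.I • D b) c‖ ≤
      10 ^ 9 * (F.L : ℝ) ^ 4 *
        ((4 * (21 + 10080 * (F.L : ℝ) ^ 3)) * (∑ b : PBond (F.P K) 0, ‖pertVar W (emb15 W (expHermField D)) b‖ ^ 2) *
            ((F.L : ℝ) ^ 2 / ((F.L : ℝ) - (1 + 2 * 10 ^ 15 * (F.L : ℝ) ^ 5 * ε₀))) * ((F.L : ℝ) ^ (K - n))⁻¹ +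
          ((4 * (3 + 720 * (F.L : ℝ) ^ 2) * (28800 * (F.L : ℝ) ^ 4)) * ((∑ x : Site (F.P K) 0, ∑ μ : Fin (F.P K).d, ∑ ν : Fin (F.P K).d,
              (if μ < ν then ∑ j : Fin 2, ∑ k : Fin 2,
                ‖(curl (torusT (F.P K) 0) (fun κ z => unitsField (toUField W) ⟨z, κ⟩) (fun κ z => pertVar W (emb15 W (expHermField D)) ⟨z, κ⟩) μ ν x) j k‖ ^ 2 else 0)) +
              (∑ x : Site (F.P K) 0, ∑ j : Fin 2, ∑ k : Fin 2,
                ‖(divB (torusT (F.P K) 0) (fun κ z => unitsField (toUField W) ⟨z, κ⟩) (fun κ z => pertVar W (emb15 W (expHermField D)) ⟨z, κ⟩) x) j k‖ ^ 2))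
            + (4 * (3 + 720 * (F.L : ℝ) ^ 2) * (600000 * (F.L : ℝ) ^ 4)) * 1 * (((F.L : ℝ) ^ (K - n)) ^ 2)⁻¹ *
              (∑ b : PBond (F.P K) 0, ‖pertVar W (emb15 W (expHermField D)) b‖ ^ 2)) *
            ((F.L : ℝ) ^ 2 / ((F.L : ℝ) ^ 3 - (1 + 2 * 10 ^ 15 * (F.L : ℝ) ^ 5 * ε₀))) * (F.L : ℝ) ^ (K - n)) := by
  have hε₀ : 0 < ε₀ := pos_of_regPr F hreg
  have hL3 : (3 : ℝ) ≤ (F.L : ℝ) := Prop7CurvedLandauKnitT3.three_le_L F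
  have hL2 : (2 : ℝ) ≤ (F.L : ℝ) := by linarith
  have hL0 : (0 : ℝ) < (F.L : ℝ) := by linarith
  -- windows: `10¹³L³ε₀ ≤ 1` and `10¹²L³ε₀ ≤ 1` from `10¹⁴L⁹ε₀ ≤ 1`
  have hL6 : (1 : ℝ) ≤ (F.L : ℝ) ^ 6 := one_le_pow₀ (by linarith)
  have hWε13 : 10 ^ 13 * (F.L : ℝ) ^ 3 * ε₀ ≤ 1 := by
    have h0 : 0 ≤ (F.L : ℝ) ^ 3 * ε₀ := by positivity
    have e : 100000000000000 * (F.L : ℝ) ^ 9 * ε₀ = 10 * (F.L : ℝ) ^ 6 * (10 ^ 13 * ((F.L : ℝ) ^ 3 * ε₀)) := by ring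
    nlinarith
  have hWε12 : 10 ^ 12 * (F.L : ℝ) ^ 3 * ε₀ ≤ 1 := by
    have h0 : 0 ≤ (F.L : ℝ) ^ 3 * ε₀ := by positivity
    nlinarith
  -- the formal towers and the damped row F0″∘F1″∘F2″
  obtain ⟨Fm, hF0, hFs⟩ := exists_iterate (bgUnits F K W)
  obtain ⟨Lin, hLin0, hLins⟩ := exists_lin (bgUnits F K W)
  have hF := l1_CmapTwS_le_damped_levelMasses_damped F h he hWe hWε13 W hreg Fm hF0 hFs Lin hLin0 hLins (fun b => Complex.I • D b) hXr
  -- the log tower IS the formal tower (windows from `RegPr`) and `e^{iD}W♭ = (emb15 W (expHermField D))♭`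
  obtain ⟨hX5, hwin⟩ := hwinr_of_regPr F n K hε₀ he.le hWe hWε12 W hreg (fun b => Complex.I • D b) hXr
  have hid := logTower_eq_iterate (bgUnits F K W) Fm hF0 hFs (fun b => Complex.I • D b) hX5 (K - n) hwin
  have hcomp : unitsField (toUField (emb15 W (expHermField D))) = fun b : PBond (F.P K) 0 => expUnit (Complex.I • D b) * bgUnits F K W b :=
    unitsField_toUField_emb15_expHermField F W D hD
  -- px17's level masses, read on the formal tower
  have hM0 := twistedLevelMass_hM_log_of_regPr F n K hε₀ hWε hs0 hs4 hsL hreg D hD hs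
  set M₀ : ℝ := ∑ b : PBond (F.P K) 0, ‖pertVar W (emb15 W (expHermField D)) b‖ ^ 2 with hM₀
  set KD : ℝ := (∑ x : Site (F.P K) 0, ∑ μ : Fin (F.P K).d, ∑ ν : Fin (F.P K).d,
      (if μ < ν then ∑ j : Fin 2, ∑ k : Fin 2,
        ‖(curl (torusT (F.P K) 0) (fun κ z => unitsField (toUField W) ⟨z, κ⟩) (fun κ z => pertVar W (emb15 W (expHermField D)) ⟨z, κ⟩) μ ν x) j k‖ ^ 2 else 0)) +
      (∑ x : Site (F.P K) 0, ∑ j : Fin 2, ∑ k : Fin 2,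
        ‖(divB (torusT (F.P K) 0) (fun κ z => unitsField (toUField W) ⟨z, κ⟩) (fun κ z => pertVar W (emb15 W (expHermField D)) ⟨z, κ⟩) x) j k‖ ^ 2) with hKD
  set A : ℝ := 4 * (21 + 10080 * (F.L : ℝ) ^ 3) * M₀ with hA
  set B : ℝ := 4 * (3 + 720 * (F.L : ℝ) ^ 2) * (28800 * (F.L : ℝ) ^ 4) * KD +
      4 * (3 + 720 * (F.L : ℝ) ^ 2) * (600000 * (F.L : ℝ) ^ 4) * 1 * (((F.L : ℝ) ^ (K - n)) ^ 2)⁻¹ * M₀ with hB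
  have hM₀0 : 0 ≤ M₀ := by rw [hM₀]; positivity
  have hKD0 : 0 ≤ KD := by
    rw [hKD]
    refine add_nonneg (sum_nonneg fun x _ => sum_nonneg fun μ _ => sum_nonneg fun ν _ => ?_) (by positivity)
    split_ifs
    · positivity
    · exact le_rfl
  have hA0 : 0 ≤ A := by rw [hA]; positivity
  have hB0 : 0 ≤ B := by rw [hB]; positivity
  have hM : ∀ l, l < K - n → ∑ b : PBond (F.P K) l, ‖Fm l (fun b => Complex.I • D b) b‖ ^ 2 ≤ A * ((F.L : ℝ) ^ l)⁻¹ + B * (F.L : ℝ) ^ l := by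
    intro l hl
    have hpt : ∀ b : PBond (F.P K) l, Fm l (fun b => Complex.I • D b) b =
        mlog (((dbarCovIterU l (unitsField (toUField W)) (unitsField (toUField (emb15 W (expHermField D)))) b *
          (emlIterU l (unitsField (toUField W)) b)⁻¹ : (Matrix (Fin 2) (Fin 2) ℂ)ˣ) : Matrix (Fin 2) (Fin 2) ℂ)) := by
      intro b
      rw [← hid l hl.le b, Units.val_mul, hcomp]
      rfl
    have h1 := hM0 l hl
    calc ∑ b : PBond (F.P K) l, ‖Fm l (fun b => Complex.I • D b) b‖ ^ 2
        = ∑ b : PBond (F.P K) l, ‖mlog (((dbarCovIterU l (unitsField (toUField W)) (unitsField (toUField (emb15 W (expHermField D)))) b *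
            (emlIterU l (unitsField (toUField W)) b)⁻¹ : (Matrix (Fin 2) (Fin 2) ℂ)ˣ) : Matrix (Fin 2) (Fin 2) ℂ))‖ ^ 2 := sum_congr rfl fun b _ => by rw [hpt b]
      _ ≤ _ := h1
      _ = A * ((F.L : ℝ) ^ l)⁻¹ + B * (F.L : ℝ) ^ l := by rw [hA, hB, hM₀, hKD]
  -- the damped level sum with `κ₀ = q·L⁻²`
  have hq0 : 0 ≤ 1 + 2 * 10 ^ 15 * (F.L : ℝ) ^ 5 * ε₀ := by positivity
  have hqL := q_lt_L F hε₀.le hWε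
  have hκ0 : 0 ≤ ((F.L : ℝ) ^ 2)⁻¹ + 2 * 10 ^ 15 * (F.L : ℝ) ^ 3 * ε₀ := by positivity
  have hκ : ((F.L : ℝ) ^ 2)⁻¹ + 2 * 10 ^ 15 * (F.L : ℝ) ^ 3 * ε₀ ≤ (1 + 2 * 10 ^ 15 * (F.L : ℝ) ^ 5 * ε₀) * ((F.L : ℝ) ^ 2)⁻¹ := (kappa0_eq F).le
  have hsum := levelSum_damped_le_q (F.L : ℝ) hL2 hq0 hqL hκ0 hκ (K - n) A B hA0 hB0 (fun l => ∑ b : PBond (F.P K) l, ‖Fm l (fun b => Complex.I • D b) b‖ ^ 2) hM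
  -- assemble
  have hC0 : (0 : ℝ) ≤ 10 ^ 9 * (F.L : ℝ) ^ 4 := by positivity
  have hrew : ∑ l ∈ Finset.range (K - n), (((F.L : ℝ) ^ 2)⁻¹ + 2 * 10 ^ 15 * (F.L : ℝ) ^ 3 * ε₀) ^ (K - n - 1 - l) *
        (10 ^ 9 * (F.L : ℝ) ^ 4 * ∑ b : PBond (F.P K) l, ‖Fm l (fun b => Complex.I • D b) b‖ ^ 2) =
      10 ^ 9 * (F.L : ℝ) ^ 4 * ∑ l ∈ Finset.range (K - n), (((F.L : ℝ) ^ 2)⁻¹ + 2 * 10 ^ 15 * (F.L : ℝ) ^ 3 * ε₀) ^ (K - n - 1 - l) *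
        ∑ b : PBond (F.P K) l, ‖Fm l (fun b => Complex.I • D b) b‖ ^ 2 := by
    rw [mul_sum]
    exact sum_congr rfl fun l _ => by ring
  rw [hrew] at hF
  refine hF.trans ((mul_le_mul_of_nonneg_left hsum hC0).trans (le_of_eq ?_))
  rw [hA, hB, hM₀, hKD]

end Summit.QuantumFields.YangMills.Theorems.Prop7CmapTwSJointRowPertVar

end
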